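import Summits.CriticalPhenomena.Ising3DConformalLimit.Theses.EnergyNotSigmaSquared
import Literature.Probability.LatticeModels.RandomCurrentsMixingCore
import Literature.Probability.LatticeModels.IntersectionClusteringInduction
import Literature.Probability.LatticeModels.AnnulusCrossing
import Literature.Probability.LatticeModels.ImprovedTreeDiagramBound
import Literature.Probability.LatticeModels.IsingThermodynamics

/-!
# Line `marginal-branch-power-law-machine` for crux `EnergyNotSigmaSquared.RungOneAdjacentMerging`
(item stmt-CriticalPhenomena-11262) — CHECKED SKELETON (crux-plan, round 1)

Idea card: `Cruxes/RungOneAdjacentMerging/Ideas/marginal-branch-power-law-machine.md`;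
line card: `Cruxes/RungOneAdjacentMerging/Lines/marginal-branch-power-law-machine.md`.

The crux (adjacent duplicated critical currents on the free box of `ℤ³` merge with probability
`→ 1`) is decided by the dichotomy `BranchG ∨ ¬BranchG` on the dyadic shares of the critical bubble:

* `BranchG` (some shells keep a fixed share of `B(2^{k+1})` infinitely often) is the SIBLING line
  `dominant-shell-concentration` (Chebyshev on the MMS cone, no mixing); it enters here as ONE stub
  (`stub_dominantBranch`), shared with that line and not re-derived.
* `¬BranchG` is THIS line: it forces `B_L = L^{o(1)}`, hence (MMS + DCP25 Thm 1.3, proved in tree) the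
  two-sided sloppy power law `‖x‖^{-3/2-θ} ≤ ⟨σ₀σ_x⟩_{β_c} ≤ ‖x‖^{-3/2+θ}` (`stub_sloppyLaw`), under which
  the Aizenman–Duminil-Copin 2021 §4/§6 programme runs at `(d,η) = (3,1/2)` with POLYNOMIAL scale
  separations: random currents' mixing (Thm 6.4 (6.8)+(6.9), qualitative error, `stub_mixing`), the
  second-moment lower bound for the window count `𝓜` on the doubly-toward MMS cone
  (`stub_pzWindows`), uniqueness of the annulus-crossing clusters `{𝓜 ≠ ∅} ∖ I_k ⊆ F₁ ∪ … ∪ F₄`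
  with the F-bounds recounted at `d = 3` (`stub_uniqueCrossings`), and the induction
  `P[A_S] ≤ (1-c₀)^{|S|}` + relocation of the far sources to an axis point + `{disjoint} ⊆ A_S`
  (`stub_assembly`).
* Both branches land on the same mass-form statement `AvoidanceVanishes` (the crux read on the tree's
  four-current weights); the DICTIONARY `AvoidanceVanishes → RungOneAdjacentMerging` (product of two
  `doubleCurrentMeasure`s on the countable configuration space = normalised `Current.srcMass`, swap of
  the two currents within each pair) is PROVED in §3, and the composition `RungOneAdjacentMerging_of`
  (§4) is `by_cases BranchG` + that dictionary.

All probabilistic statements are in the tree's un-normalised current-sum form on the finite free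
box `Λ_n = box 3 n` with the crux's graph `(zdGraph 3).comap Subtype.val` (`Current.srcMass`,
`Current.srcNrm`, `Current.FourCfg`, `Current.FourLocal`, `Current.edgesWithin/Beyond`,
`Current.IkEvent`), "eventually in `n`" exactly as in the crux.

`lean check`: sorries ONLY inside `stub_*`; `RungOneAdjacentMerging_of` (no hypotheses: uses the six
stubs and the proved dictionary) contains no `sorry` and concludes literally
`Summit.CriticalPhenomena.Ising3DConformalLimit.Theses.EnergyNotSigmaSquared.RungOneAdjacentMerging`
(the ONLY theorem of the file concluding it by name, as the by-name skeleton audit requires);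
`cruxBody_of_parts` (the six stub statements as `type_of%` hypotheses; closed, standard axioms only)
concludes the decl's body verbatim (`CruxBody`, `cruxBody_iff : CruxBody ↔ … := Iff.rfl`).
-/

noncomputable section

namespace Summit.CriticalPhenomena.Ising3DConformalLimit.Cruxes.RungOneAdjacentMerging.MarginalBranchPowerLawMachine

open Literature.Probability.LatticeModels MeasureTheory
open scoped ENNReal symmDiff BigOperators

/-! ### §0. Vocabulary (bodies only; no axioms, no sorries) -/

/-- The critical bubble diagram of `ℤ³` truncated at distance `L`: `B(L) = ∑_{‖u‖ ≤ L} ⟨σ₀σ_u⟩²_{β_c}`. -/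
abbrev bubble (L : ℝ) : ℝ := bubbleDiagram (criticalTwoPoint 3) L

/-- Shell `k` is `ρ`-DOMINANT: it carries at least a fraction `ρ` of `B(2^{k+1})`
(sibling card `dominant-shell-concentration`, its `IsDominantShell`). -/
def IsDominantShell (ρ : ℝ) (k : ℕ) : Prop :=
  ρ * bubble (2 ^ (k + 1)) ≤ bubble (2 ^ (k + 1)) - bubble (2 ^ k)

/-- `BranchG`: for some `ρ > 0` infinitely many dyadic shells are `ρ`-dominant (sibling card's branch
variable; THIS line is its negation). -/
def BranchG : Prop :=
  ∃ ρ : ℝ, 0 < ρ ∧ ∀ k₀ : ℕ, ∃ k : ℕ, k₀ ≤ k ∧ IsDominantShell ρ k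

/-- The two-sided SLOPPY POWER LAW with exponent `3/2` ("marginal `ℤ³`", `η_eff = 1/2`): for every
`θ > 0`, eventually `‖x‖^{-3/2-θ} ≤ ⟨σ₀σ_x⟩_{β_c} ≤ ‖x‖^{-3/2+θ}` (ADC21 Assumption 4.1 with
`(d,η) = (3,1/2)` up to `‖x‖^{o(1)}`). -/
def SloppyPowerLaw : Prop :=
  ∀ θ : ℝ, 0 < θ → ∃ R : ℝ, ∀ x : Site 3, R ≤ ‖x‖ →
    (‖x‖ : ℝ) ^ (-(3 / 2 : ℝ) - θ) ≤ criticalTwoPoint 3 x ∧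
      criticalTwoPoint 3 x ≤ (‖x‖ : ℝ) ^ (-(3 / 2 : ℝ) + θ)

/-- The crux's graph: nearest-neighbour `ℤ³` induced on the box `Λ_n = box 3 n` (literally the
expression of the route decl). -/
abbrev BoxGraph (n : ℕ) : SimpleGraph ↥(box 3 n) :=
  (zdGraph 3).comap (Subtype.val : ↥(box 3 n) → Site 3)

/-- Uniform critical couplings `K ≡ β_c(3)` on the box graph. -/
abbrev Kc (n : ℕ) : (BoxGraph n).edgeFinset → ℝ := fun _ => criticalBeta 3

/-- Un-normalised expectation of `Φ ≥ 0` under the four currents `P^{oy,∅} ⊗ P^{ay',∅}` on `Λ_n`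
(tree layout `Current.srcWeight`: in each pair the FIRST current is sourceless, the second carries
the sources `{o,y}` resp. `{a,y'}`; the crux's `doubleCurrentMeasure _ _ ({o}∆{y}) ∅` has them the
other way round — immaterial for events of the sums `n₁+n₃`, `n₂+n₄`: the swap is carried out in the
proved dictionary of §3, `disjInd_swap_eq_indicator`, `prod_real_le_of_mass_le`). -/
def Mass (n : ℕ) (o y a y' : ↥(box 3 n)) (Φ : Current.FourCfg (BoxGraph n) → ℝ≥0∞) : ℝ≥0∞ :=
  Current.srcMass (Kc n) ({o} ∆ {y}) ({a} ∆ {y'}) Φ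

/-- Its normalisation `Z[∅]Z[{o,y}]·Z[∅]Z[{a,y'}]`. -/
def Nrm (n : ℕ) (o y a y' : ↥(box 3 n)) : ℝ≥0∞ :=
  Current.srcNrm (Kc n) ({o} ∆ {y}) ({a} ∆ {y'})

/-- The annulus `{ℓ ≤ dist(o,·) ≤ ℓ'}` of `Λ_n` (sup-norm distance of `ℤ³`). -/
def ann (n : ℕ) (o : ↥(box 3 n)) (ℓ ℓ' : ℕ) : Finset ↥(box 3 n) :=
  Finset.univ.filter fun v => (ℓ : ℝ) ≤ dist o v ∧ dist o v ≤ ℓ'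

/-- ADC's event `I(ℓ,ℓ')` for the four currents `((n₁,n₃),(n₂,n₄))`: unique crossing clusters of the
annulus in `n₁+n₃` and in `n₂+n₄`, and they meet (tree `Current.IkEvent`, centre `o`). -/
def Ik (n : ℕ) (o : ↥(box 3 n)) (ℓ ℓ' : ℕ) (pq : Current.FourCfg (BoxGraph n)) : Prop :=
  Current.IkEvent (ann n o ℓ ℓ') ℓ ℓ' o (pq.1.1 + pq.1.2) (pq.2.1 + pq.2.2)

/-- The window count is non-zero, `𝓜(m,M) ≠ ∅`: some `u` with `m ≤ dist(o,u) ≤ M` lies in the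
cluster of `o` in `n₁+n₃` AND in the cluster of `a` in `n₂+n₄` (two centres `o = 0`, `a = e₂`). -/
def Meet (n : ℕ) (o a : ↥(box 3 n)) (m M : ℕ) (pq : Current.FourCfg (BoxGraph n)) : Prop :=
  ∃ u : ↥(box 3 n), ((m : ℝ) ≤ dist o u ∧ dist o u ≤ M) ∧
    u ∈ (pq.1.1 + pq.1.2).cluster o ∧ u ∈ (pq.2.1 + pq.2.2).cluster a

open Classical in
/-- Indicator of `𝓜(m,M) ≠ ∅`. -/
def meetInd (n : ℕ) (o a : ↥(box 3 n)) (m M : ℕ) (pq : Current.FourCfg (BoxGraph n)) : ℝ≥0∞ :=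
  if Meet n o a m M pq then 1 else 0

open Classical in
/-- Indicator of `{𝓜(m,M) ≠ ∅} ∖ I(ℓ,ℓ')` (the event covered by `F₁ ∪ … ∪ F₄` and their twins). -/
def meetNotIkInd (n : ℕ) (o a : ↥(box 3 n)) (ℓ m M ℓ' : ℕ) (pq : Current.FourCfg (BoxGraph n)) :
    ℝ≥0∞ :=
  if Meet n o a m M pq ∧ ¬ Ik n o ℓ ℓ' pq then 1 else 0

/-- "Eventually in the box, at the named vertices": for all large `n` and all vertices `o a y y'` of
`Λ_n` sitting at `0, e₂, x, x + e₂` (the crux's own quantifier block), `P n o a y y'`. -/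
def EventuallyInBox (x : Site 3)
    (P : ∀ n : ℕ, ↥(box 3 n) → ↥(box 3 n) → ↥(box 3 n) → ↥(box 3 n) → Prop) : Prop :=
  ∃ n₀ : ℕ, ∀ n : ℕ, n₀ ≤ n → ∀ o a y y' : ↥(box 3 n),
    (o : Site 3) = 0 → (a : Site 3) = Pi.single 1 1 → (y : Site 3) = x →
      (y' : Site 3) = x + Pi.single 1 1 → P n o a y y'

/-- The axis far point `L·e₁`. -/
abbrev axisPt (L : ℕ) : Site 3 := Pi.single 0 (L : ℤ)

open Classical in
/-- Indicator of the CRUX'S EVENT read on the four currents (tree layout): no vertex `u` lies both in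
the cluster of `o` in `n₁+n₃` and in the cluster of `a` in `n₂+n₄` (the route decl's
`{pq | ∀ u, ¬ (pq.1 ∈ tracedConn G o u ∧ pq.2 ∈ tracedConn G a u)}` through the swap of the two
currents within each pair, `disjInd_swap_eq_indicator`). -/
def disjInd (n : ℕ) (o a : ↥(box 3 n)) (pq : Current.FourCfg (BoxGraph n)) : ℝ≥0∞ :=
  if ∀ u : ↥(box 3 n), ¬ (u ∈ (pq.1.1 + pq.1.2).cluster o ∧ u ∈ (pq.2.1 + pq.2.2).cluster a)
    then 1 else 0

/-- **AvoidanceVanishes** — the crux in the tree's un-normalised mass form, the common landing point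
of both branches: `Mass(𝟙[clusters of 0 and e₂ disjoint]) ≤ ε · Nrm` for `‖x‖ ≥ R(ε)`, eventually in
the box (⇔ `P^{0x,∅} ⊗ P^{e₂ x+e₂,∅}[disjoint] ≤ ε`; the passage to the route decl's product measure
is the proved dictionary of §3). -/
def AvoidanceVanishes : Prop :=
  ∀ ε : ℝ, 0 < ε → ∃ R : ℝ, ∀ x : Site 3, R ≤ ‖x‖ →
    EventuallyInBox x fun n o a y y' =>
      Mass n o y a y' (disjInd n o a) ≤ ENNReal.ofReal ε * Nrm n o y a y'

/-- Polynomially separated radii `ℓ < n ≤ m ≤ M ≤ N < ℓ'` with `ℓ^p ≤ n`, `n^p ≤ m`, `M^p ≤ N`,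
`N^p ≤ ℓ'` (the printed `ℓ_k ≪ n ≪ m ≤ M ≪ N ≪ ℓ_{k+1}` of ADC21 Lemma 4.4 / 6.2, exponents free). -/
def SepRadii (p ℓ n m M N ℓ' : ℕ) : Prop :=
  ℓ < n ∧ n ≤ m ∧ m ≤ M ∧ M ≤ N ∧ N < ℓ' ∧ ℓ ^ p ≤ n ∧ n ^ p ≤ m ∧ M ^ p ≤ N ∧ N ^ p ≤ ℓ'

/-! ### §1. The intermediate statements of the line -/

/-- **BoxMixing** — random currents' mixing at `d = 3` for the `s = 4, t = 2` system of the crux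
(ADC21 Thm 6.4, (6.8) and (6.9), in the QUALITATIVE form ADC state for `d = 3` on p. 22: "for every
`n`, `s` and `ε` there exists `N` … with an error `ε`"; Panis arXiv:2406.15243 Thm 2.4 for `d ≥ 3`),
read on the free box eventually in its size, one-sided as consumed by the induction:
for `Φ ≤ 1` local on the edges within `Λ_r(0)` and `Ψ ≤ 1` local on the edges outside `Λ_R(0)`,
(6.8) `E[ΦΨ] ≤ E[Φ]E[Ψ] + η` for the far sources `(x, x+e₂)`, and (6.9) `E_x[Φ] ≤ E_z[Φ] + η` for two
far source pairs `(x,x+e₂)`, `(z,z+e₂)` beyond `Λ_{R+2}`. -/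
def BoxMixing : Prop :=
  ∀ η : ℝ, 0 < η → ∀ r : ℕ, ∃ R : ℕ, r ≤ R ∧
    ∀ x z : Site 3, (R : ℝ) + 2 ≤ ‖x‖ → (R : ℝ) + 2 ≤ ‖z‖ →
      ∃ n₀ : ℕ, ∀ n : ℕ, n₀ ≤ n → ∀ o a y y' w w' : ↥(box 3 n),
        (o : Site 3) = 0 → (a : Site 3) = Pi.single 1 1 →
        (y : Site 3) = x → (y' : Site 3) = x + Pi.single 1 1 →
        (w : Site 3) = z → (w' : Site 3) = z + Pi.single 1 1 →
        ∀ Φ Ψ : Current.FourCfg (BoxGraph n) → ℝ≥0∞, (∀ pq, Φ pq ≤ 1) → (∀ pq, Ψ pq ≤ 1) →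
          Current.FourLocal (Current.edgesWithin o r) Φ →
          Current.FourLocal (Current.edgesBeyond o R) Ψ →
            Mass n o y a y' (Φ * Ψ) * Nrm n o y a y' ≤
                Mass n o y a y' Φ * Mass n o y a y' Ψ + ENNReal.ofReal η * Nrm n o y a y' ^ 2 ∧
            Mass n o y a y' Φ * Nrm n o w a w' ≤
                Mass n o w a w' Φ * Nrm n o y a y' + ENNReal.ofReal η * (Nrm n o y a y' * Nrm n o w a w')

/-- **PZWindows** — the second-moment ("Paley–Zygmund") half of the intersection property, x-free:
there is `c₁ > 0` such that beyond every `ℓ₀` and for every separation exponent `p` there are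
`p`-separated radii `ℓ < n ≤ m ≤ M ≤ N < ℓ'` for which, with far sources at the axis point `L·e₁` and
its `e₂`-translate, ANY `L ≥ 4ℓ'`, the window count is non-zero with probability `≥ c₁`:
`c₁ · Nrm ≤ Mass(𝟙[𝓜(m,M) ≠ ∅])` eventually in the box (ADC21 Lemma 4.4/6.2 first half, run with the
doubly-toward MMS cone and weights `G(0,v)G(e₂,v)/(a₁(v)a₂(v)) ≤ 1`, so that no ratio at scale `L`
enters; window share from `B(β_c) = ∞` (DCP25 Thm 1.8, tree) + doubling density + fraction-form harvest). -/
def PZWindows : Prop :=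
  ∃ c₁ : ℝ, 0 < c₁ ∧ ∀ p ℓ₀ : ℕ, ∃ ℓ n m M N ℓ' : ℕ, ℓ₀ ≤ ℓ ∧ SepRadii p ℓ n m M N ℓ' ∧
    ∀ L : ℕ, 4 * ℓ' ≤ L →
      EventuallyInBox (axisPt L) fun nn o a y y' =>
        ENNReal.ofReal c₁ * Nrm nn o y a y' ≤ Mass nn o y a y' (meetInd nn o a m M)

/-- **UniqueCrossings** — uniqueness of the annulus-crossing clusters w.h.p. (ADC21 proof of Lemma
4.4: `{𝓜 ≠ ∅} ∖ I_k ⊆ F₁ ∪ F₂ ∪ F₃ ∪ F₄` and twins, tree `Current.ikEvent_of_not_F`, with the four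
bounds (4.5)–(4.8)/(6.11)–(6.13) RECOUNTED at `d = 3` under `SloppyPowerLaw`): there is an unbounded
set `Far` of admissible far scales (intended: `A`-doubling axis scales, where
`⟨σ_wσ_{Le₁}⟩ ≤ A⟨σ₀σ_{Le₁}⟩` for `‖w‖ ≤ L/4` by MMS) such that for every `c > 0`, for some exponent `p`
and threshold `ℓ₀`, for ALL `p`-separated radii beyond `ℓ₀` and all `Far L ≥ 4ℓ'`:
`Mass(𝟙[𝓜(m,M) ≠ ∅ ∧ ¬ I(ℓ,ℓ')]) ≤ c · Nrm` eventually in the box. -/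
def UniqueCrossings : Prop :=
  ∃ Far : ℕ → Prop, (∀ L₀ : ℕ, ∃ L : ℕ, L₀ ≤ L ∧ Far L) ∧
    ∀ c : ℝ, 0 < c → ∃ p ℓ₀ : ℕ, ∀ ℓ n m M N ℓ' : ℕ, ℓ₀ ≤ ℓ → SepRadii p ℓ n m M N ℓ' →
      ∀ L : ℕ, Far L → 4 * ℓ' ≤ L →
        EventuallyInBox (axisPt L) fun nn o a y y' =>
          Mass nn o y a y' (meetNotIkInd nn o a ℓ m M ℓ') ≤ ENNReal.ofReal c * Nrm nn o y a y'

/-! ### §2. Registered stubs -/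

/-- **stub_dominantBranch** (the SIBLING line `dominant-shell-concentration`, = its Transfer
`C⁺ := BranchG → RungOneAdjacentMerging`, landing here on the mass form `AvoidanceVanishes`; shared
with that line, closes when its skeleton closes):
under `BranchG`, log-scale concentration of the pointwise-normalised coincidence count over polynomially
separated dominant shells on the MMS cone (Prop. A.3 twice, P2 only at the larger scale, Chebyshev).
[size L; leans on: `Current.ecurrentSum_empty_mul_tsum_connInd_mul_connInd_le`,
`tsum_epairWeight_mul_indicator_mem_cluster`, MMS, `twoPointFree_criticalBeta_gradient_estimate`] -/
theorem stub_dominantBranch : BranchG → AvoidanceVanishes := by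
  sorry

/-- **stub_sloppyLaw** (the regularity gift): `¬BranchG` ⇒ for every `ρ > 0` eventually
`B(2^{k+1}) < B(2^k)/(1-ρ)`, so `B_L = L^{o(1)}`; MMS (`G(y) ≥ G(‖y‖₁e₁) ≥ G(6Le₁)` on the shell
`L < ‖y‖ ≤ 2L`, and `G(x) ≤ G(‖x‖_∞e₁)`) gives the upper half `‖x‖^{-3/2+θ}`; DCP25 Thm 1.3
(`dcp_criticalTwoPoint_axis_lower_holds`: `G(ne₁) ≥ c₁/(χ_{4n} + n∑_{k≤2n} kG(ke₁))`) fed with the upper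
half and MMS gives the lower half; `twoPointPlus_criticalBeta_eq_twoPointFree_holds` moves between the
plus and free critical states. [size M] -/
theorem stub_sloppyLaw : ¬ BranchG → SloppyPowerLaw := by
  sorry

/-- **stub_mixing** (H2 of the card; ADC21 Thm 6.4 at `d = 3`, free box, `s = 4`, `t = 2`): under the
sloppy law the printed proof of §6.2 runs with Lemma 6.7 recounted — backbone excursion
`∑_{∂Λ_R} G(x,v)G(v,u)/G(x,u) ≲ R^{-1+2θ}M^{3/2+θ}`, sourceless crossing `∑_{∂Λ_R×∂Λ_N} G² ≲ R²N^{-1+2θ}`,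
so `R = M^{3/2+δ}`, `N ≥ M^{3+3δ}`, `m ≥ n^{2+δ}` (polynomial; triage r1-1) — concentration of `𝐍` from
Prop. 6.6 verbatim on regular scales (abundance Thm 5.12 is printed for `d > 2`; Panis 2406.15243 Thm 5.3;
its inputs sliding-scale IRB / gradient estimate / MMS are in tree for `d ≥ 3`), (6.16) = tree
`Current.mixingCore` (finite graph, `hB`/`hG` as hypotheses), endgame (6.8)/(6.9) = tree
`RandomCurrentsMixingEndgame`; finite-volume two-point functions within `1+o(1)` of `criticalTwoPoint 3`
on the finitely many pairs involved (`hasBoxLimit_isingCorr_free_holds`). Unconditional printed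
alternative: ADS15 route (ADC21 p. 22) / Panis Thm 2.4 (infinite volume). [size XL — hardest] -/
theorem stub_mixing : SloppyPowerLaw → BoxMixing := by
  sorry

/-- **stub_pzWindows** (H3 of the card, first half of Lemma 4.4/6.2 at `d = 3`): choose
`ℓ ≥ ℓ₀`, `n = ℓ^p`, `m = n^p`; by `B(β_c) = ∞` (`NNIsing.bubbleDiagram_criticalBeta_three_eq_top`) take
`M` with `B(M) ≥ 100·B(2m)` and `2M, 4M` doubling axis scales (positive density from `G ≥ c/r²`), so that
the window `[m,M]` carries a fixed share of `B(2M)`; then `N = M^p`, `ℓ' = N^p`. On the doubly-toward cone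
`W = {u₁ ≥ |u₂|+|u₃|, m ≤ ‖u‖ ≤ M}` (towards `Le₁`, `L ≥ 4M`; ADC Rem. 6.5 footnote = MMS), with
`N := ∑_{v∈W} c(v)𝟙[v∈C₁(0)]𝟙[v∈C₂(e₂)]`, `c(v) = G(0,v)G(e₂,v)/(a₁(v)a₂(v)) ≤ 1`:
`E N ≥ c∑_W G(v)²` (exact one-point functions `tsum_epairWeight_mul_indicator_mem_cluster` + one-step GKS),
`E N² ≤ C·(∑_W G²)·B(2M)` (Prop. A.3 `Current.ecurrentSum_empty_mul_tsum_connInd_mul_connInd_le` once per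
system, far ratios `≤ 1` on the cone), so `P[𝓜 ≠ ∅] ≥ (EN)²/EN² ≥ c₁`, uniformly in `L`; the cone
captures a fixed fraction of the window mass by the fraction-form harvest (doubling shells carry `≥ 1/17`
of any window, triage r1-1 E5 / r1-3 Note H) — the sloppy law makes every shell's decay exponent
`3/2 ± o(1)`, which is where the hypothesis is used. [size L] -/
theorem stub_pzWindows : SloppyPowerLaw → PZWindows := by
  sorry

/-- **stub_uniqueCrossings** (H1 of the card, second half of Lemma 4.4/6.2 at `d = 3`): with
`Far L :⇔ L` an `A`-doubling axis scale (`G((L/2)e₁) ≤ A·G(Le₁)`, unbounded since `G ≥ c/r²`), MMS gives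
`G(w, Le₁) ≤ A·G(0, Le₁)` for `‖w‖ ≤ L/4`, which is all the two-passage chain rule needs of the far point.
Deterministic part: tree `Current.ikEvent_of_not_F` (`{𝓜≠∅}∖I ⊆ F₁∪F₂∪F₃∪F₄ ∪ twins`; the twin for
`(n₂,n₄)` has its source `e₂` at distance `1 ≤ ℓ` from the centre — an off-centre variant of the tree
lemma is needed). Bounds under the sloppy law (`G = r^{-3/2±θ}`): `F₁ ≲ A ℓ² n^{-1+2θ}`, `F₂ ≲ n² m^{-1+2θ}`
(depleted sourceless crossing ≤ `∑G²`, `Current.sourcelessConnMass_mul_le_of_le`), `F₃ ≲ M² N^{-1+2θ}`,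
`F₄ ≲ A N² ℓ'^{-1+2θ}` (two-passage chain rule `BackboneChainRuleTwo`, `Current.tsum_offCross_mul_sq_le`),
all `≤ c/8` once `p ≥ 3` and `ℓ ≥ ℓ₀(c, A, θ)`. [size L] -/
theorem stub_uniqueCrossings : SloppyPowerLaw → UniqueCrossings := by
  sorry

/-- **stub_assembly** (H4 of the card; ADC21 proof of Prop. 4.3/6.1, p. 14 and p. 22, for the crux's
source layout): given `ε`, put `c₀ := min(c₁,1)/4`, take `s` with `(1-c₀)^s ≤ ε/3`, and choose `s` annuli
`(ℓ_j,ℓ'_j)` from `PZWindows` (with the exponent `p` of `UniqueCrossings` at `c := c₁/2`) inductively so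
sparse that `BoxMixing` (6.8) with `r = ℓ'_{j-1}`, `η_j = c₀(1-c₀)^{j-1}` applies across the gap
`[ℓ'_{j-1}, ℓ_j]`; take `L` with `Far L`, `L ≥ 4ℓ'_s`, `L ≥ R_rel + 2`. Then at the far pair
`(Le₁, Le₁+e₂)`: `Mass(𝟙[I_j]) ≥ Mass(𝟙[𝓜_j≠∅]) - Mass(𝟙[𝓜_j≠∅ ∧ ¬I_j]) ≥ 2c₀·Nrm`, and the induction
(tree `Current.fourMass_asInd_le_pow`, verbatim for `srcMass` with sources `{0,y},{e₂,y'}`; locality of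
`I_j` from `fourLocal_ikInd_within/beyond`) gives `P_{Le₁}[A_S] ≤ (1-c₀)^s`; relocation (6.9) gives
`P_x[A_S] ≤ P_{Le₁}[A_S] + ε/3` for every `‖x‖ ≥ R_rel + 2 =: R`; `{clusters of 0 and e₂ disjoint} ⊆ A_S`
(two-centre variant of `Current.inter_nonempty_of_ikEvent` via `exists_crossAt_of_mem_cluster`, using
`x ∈ C_{n₁+n₃}(0)`, `x+e₂ ∈ C_{n₂+n₄}(e₂)` from the sources, `1 ≤ ℓ_j`, `ℓ'_j + 1 ≤ ‖x‖`); normalise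
(`Nrm ≠ 0` by `ecurrentSum_pair_ne_zero_box`), eventually in `n` (max of finitely many thresholds). The
passage to the route decl's product measure is NOT part of this stub (proved in §3). [size M/L] -/
theorem stub_assembly : BoxMixing → PZWindows → UniqueCrossings → AvoidanceVanishes := by
  sorry

/-! ### §3. The dictionary (PROVED): product double-current measure = normalised mass -/

section Dictionary

variable {W : Type*} [Fintype W] [DecidableEq W] (G : SimpleGraph W) [DecidableRel G.Adj]

/-- The double-current measure of a singleton is its normalised pair weight. -/
theorem doubleCurrentMeasure_apply_singleton (β : ℝ) (A B : Finset W) (p : Current G × Current G) :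
    doubleCurrentMeasure G β A B {p} =
      ENNReal.ofReal (pairWeight G β A B p / (currentSum G β A * currentSum G β B)) := by
  classical
  rw [doubleCurrentMeasure, Measure.sum_apply _ (measurableSet_singleton p)]
  simp only [Measure.smul_apply, smul_eq_mul, Measure.dirac_apply' _ (measurableSet_singleton p)]
  rw [tsum_eq_single p]
  · simp
  · intro q hq
    simp [hq]

/-- `SFinite` for the double-current measure (a countable sum of scaled Dirac masses). -/
instance instSFiniteDoubleCurrentMeasure (β : ℝ) (A B : Finset W) :
    SFinite (doubleCurrentMeasure G β A B) := by
  unfold doubleCurrentMeasure; infer_instance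

/-- The product of two double-current measures on a singleton. -/
theorem prod_doubleCurrentMeasure_apply_singleton (β : ℝ) (A₁ B₁ A₂ B₂ : Finset W)
    (pq : (Current G × Current G) × (Current G × Current G)) :
    ((doubleCurrentMeasure G β A₁ B₁).prod (doubleCurrentMeasure G β A₂ B₂)) {pq} =
      ENNReal.ofReal (pairWeight G β A₁ B₁ pq.1 / (currentSum G β A₁ * currentSum G β B₁)) *
        ENNReal.ofReal (pairWeight G β A₂ B₂ pq.2 / (currentSum G β A₂ * currentSum G β B₂)) := by
  obtain ⟨p, q⟩ := pq
  rw [← Set.singleton_prod_singleton, Measure.prod_prod, doubleCurrentMeasure_apply_singleton,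
    doubleCurrentMeasure_apply_singleton]

/-- **The product of two double-current measures of an event, as a series** over the countable
configuration space of the four currents. -/
theorem prod_doubleCurrentMeasure_apply (β : ℝ) (A₁ B₁ A₂ B₂ : Finset W)
    (E : Set ((Current G × Current G) × (Current G × Current G))) :
    ((doubleCurrentMeasure G β A₁ B₁).prod (doubleCurrentMeasure G β A₂ B₂)) E =
      ∑' pq, E.indicator (fun pq =>
        ENNReal.ofReal (pairWeight G β A₁ B₁ pq.1 / (currentSum G β A₁ * currentSum G β B₁)) *
          ENNReal.ofReal (pairWeight G β A₂ B₂ pq.2 / (currentSum G β A₂ * currentSum G β B₂))) pq := by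
  rw [← Measure.tsum_indicator_apply_singleton _ E (Set.to_countable E).measurableSet]
  refine tsum_congr fun pq => ?_
  by_cases hpq : pq ∈ E
  · rw [Set.indicator_of_mem hpq, Set.indicator_of_mem hpq]
    exact prod_doubleCurrentMeasure_apply_singleton G β A₁ B₁ A₂ B₂ pq
  · rw [Set.indicator_of_notMem hpq, Set.indicator_of_notMem hpq]

/-- Degenerate normaliser: the double-current measure is the junk value `0` (as in the tree's
`doubleCurrentMeasure_eq_zero_of_currentSum`, restated here to keep the import cone small). -/
theorem doubleCurrentMeasure_eq_zero_of_currentSum_eq_zero {β : ℝ} {A B : Finset W}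
    (h : currentSum G β A * currentSum G β B = 0) : doubleCurrentMeasure G β A B = 0 := by
  rw [doubleCurrentMeasure]
  have hf : (fun p : Current G × Current G =>
      ENNReal.ofReal (pairWeight G β A B p / (currentSum G β A * currentSum G β B)) • Measure.dirac p) =
      fun _ => 0 := by
    funext p
    rw [h, div_zero, ENNReal.ofReal_zero, zero_smul]
  rw [hf, Measure.sum_zero]

/-- The real pair weight with the SOURCED current first is the tree's `ℝ≥0∞` pair weight with the
sourceless current first (uniform coupling `K ≡ β ≥ 0`). -/
theorem ofReal_pairWeight_eq_epairWeight_swap {β : ℝ} (hβ : 0 ≤ β) (A : Finset W)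
    (p : Current G × Current G) :
    ENNReal.ofReal (pairWeight G β A ∅ p) = epairWeight (fun _ : G.edgeFinset => β) ∅ A p.swap := by
  obtain ⟨n₁, n₃⟩ := p
  simp only [pairWeight, epairWeight, Prod.swap_prod_mk, Current.eweight]
  by_cases h₁ : n₁.sources = A
  · by_cases h₃ : n₃.sources = ∅
    · rw [if_pos ⟨h₁, h₃⟩, if_pos ⟨h₃, h₁⟩, ENNReal.ofReal_mul (Current.weight_nonneg hβ _), mul_comm]
      rfl
    · rw [if_neg (fun h => h₃ h.2), if_neg (fun h => h₃ h.1), ENNReal.ofReal_zero]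
  · rw [if_neg (fun h => h₁ h.1), if_neg (fun h => h₁ h.2), ENNReal.ofReal_zero]

/-- The real current sum is the tree's `ℝ≥0∞` current sum (uniform coupling `K ≡ β ≥ 0`). -/
theorem ofReal_currentSum_eq_ecurrentSum {β : ℝ} (hβ : 0 ≤ β) (A : Finset W) :
    ENNReal.ofReal (currentSum G β A) = ecurrentSum (fun _ : G.edgeFinset => β) A := by
  rw [currentSum_eq_wcurrentSum, ecurrentSum_eq_ofReal (fun _ => hβ)]

end Dictionary

/-- The swap within both pairs: crux layout `((n₁,n₃),(n₂,n₄))` ↦ tree layout `((n₃,n₁),(n₄,n₂))`. -/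
abbrev swapEquiv (n : ℕ) : Current.FourCfg (BoxGraph n) ≃ Current.FourCfg (BoxGraph n) :=
  (Equiv.prodComm _ _).prodCongr (Equiv.prodComm _ _)

/-- The crux's event, read through the swap, is `disjInd`. -/
theorem disjInd_swap_eq_indicator {n : ℕ} (o a : ↥(box 3 n)) (pq : Current.FourCfg (BoxGraph n)) :
    disjInd n o a (swapEquiv n pq) =
      {pq : Current.FourCfg (BoxGraph n) | ∀ u : ↥(box 3 n),
          ¬ (pq.1 ∈ tracedConn (BoxGraph n) o u ∧ pq.2 ∈ tracedConn (BoxGraph n) a u)}.indicator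
        (fun _ => (1 : ℝ≥0∞)) pq := by
  classical
  obtain ⟨⟨n₁, n₃⟩, ⟨n₂, n₄⟩⟩ := pq
  have key : (∀ u : ↥(box 3 n), ¬ (u ∈ (n₃ + n₁).cluster o ∧ u ∈ (n₄ + n₂).cluster a)) ↔
      (∀ u : ↥(box 3 n), ¬ ((n₁, n₃) ∈ tracedConn (BoxGraph n) o u ∧
        (n₂, n₄) ∈ tracedConn (BoxGraph n) a u)) := by
    simp only [Current.mem_cluster_iff, mem_tracedConn_iff, add_comm n₃ n₁, add_comm n₄ n₂]
  have hσ : swapEquiv n ((n₁, n₃), (n₂, n₄)) = ((n₃, n₁), (n₄, n₂)) := rfl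
  rw [hσ]
  simp only [disjInd, Set.indicator_apply, Set.mem_setOf_eq]
  split_ifs with h1 h2 h2
  · rfl
  · exact absurd (key.1 h1) h2
  · exact absurd (key.2 h2) h1
  · rfl

/-- **Dictionary, the inequality the crux needs**: if `Mass(𝟙[disjoint]) ≤ ε·Nrm` in the box `Λ_n`,
then the product double-current probability of the route decl's event is `≤ ε` (junk normalisers
included: then the measure is `0`). -/
theorem prod_real_le_of_mass_le {n : ℕ} (o a y y' : ↥(box 3 n)) {ε : ℝ} (hε : 0 ≤ ε)
    (hM : Mass n o y a y' (disjInd n o a) ≤ ENNReal.ofReal ε * Nrm n o y a y') :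
    ((doubleCurrentMeasure (BoxGraph n) (criticalBeta 3) ({o} ∆ {y}) ∅).prod
        (doubleCurrentMeasure (BoxGraph n) (criticalBeta 3) ({a} ∆ {y'}) ∅)).real
      {pq | ∀ u : ↥(box 3 n), ¬ (pq.1 ∈ tracedConn (BoxGraph n) o u ∧
        pq.2 ∈ tracedConn (BoxGraph n) a u)} ≤ ε := by
  classical
  have hβ : 0 ≤ criticalBeta 3 := criticalBeta_nonneg 3
  -- degenerate normalisers: the junk measure `0`
  by_cases hZ₁ : currentSum (BoxGraph n) (criticalBeta 3) ({o} ∆ {y}) *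
      currentSum (BoxGraph n) (criticalBeta 3) ∅ = 0
  · rw [measureReal_def, doubleCurrentMeasure_eq_zero_of_currentSum_eq_zero (BoxGraph n) hZ₁,
      Measure.zero_prod, Measure.coe_zero, Pi.zero_apply, ENNReal.toReal_zero]
    exact hε
  by_cases hZ₂ : currentSum (BoxGraph n) (criticalBeta 3) ({a} ∆ {y'}) *
      currentSum (BoxGraph n) (criticalBeta 3) ∅ = 0
  · rw [measureReal_def, doubleCurrentMeasure_eq_zero_of_currentSum_eq_zero (BoxGraph n) hZ₂,
      Measure.prod_zero, Measure.coe_zero, Pi.zero_apply, ENNReal.toReal_zero]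
    exact hε
  have hZ₁pos : 0 < currentSum (BoxGraph n) (criticalBeta 3) ({o} ∆ {y}) *
      currentSum (BoxGraph n) (criticalBeta 3) ∅ :=
    lt_of_le_of_ne (mul_nonneg (currentSum_nonneg _ hβ _) (currentSum_nonneg _ hβ _)) (Ne.symm hZ₁)
  have hZ₂pos : 0 < currentSum (BoxGraph n) (criticalBeta 3) ({a} ∆ {y'}) *
      currentSum (BoxGraph n) (criticalBeta 3) ∅ :=
    lt_of_le_of_ne (mul_nonneg (currentSum_nonneg _ hβ _) (currentSum_nonneg _ hβ _)) (Ne.symm hZ₂)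
  -- the normalisers in `ℝ≥0∞`
  set N₁ : ℝ≥0∞ := ENNReal.ofReal (currentSum (BoxGraph n) (criticalBeta 3) ({o} ∆ {y}) *
      currentSum (BoxGraph n) (criticalBeta 3) ∅) with hN₁
  set N₂ : ℝ≥0∞ := ENNReal.ofReal (currentSum (BoxGraph n) (criticalBeta 3) ({a} ∆ {y'}) *
      currentSum (BoxGraph n) (criticalBeta 3) ∅) with hN₂
  have hN₁0 : N₁ ≠ 0 := (ENNReal.ofReal_pos.2 hZ₁pos).ne'
  have hN₂0 : N₂ ≠ 0 := (ENNReal.ofReal_pos.2 hZ₂pos).ne'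
  have hNrm : Nrm n o y a y' = N₁ * N₂ := by
    rw [hN₁, hN₂, ENNReal.ofReal_mul (currentSum_nonneg _ hβ _),
      ENNReal.ofReal_mul (currentSum_nonneg _ hβ _), ofReal_currentSum_eq_ecurrentSum _ hβ,
      ofReal_currentSum_eq_ecurrentSum _ hβ, ofReal_currentSum_eq_ecurrentSum _ hβ]
    simp only [Nrm, Current.srcNrm]
    ring
  have hNrm0 : Nrm n o y a y' ≠ 0 := by rw [hNrm]; exact mul_ne_zero hN₁0 hN₂0
  have hNrmT : Nrm n o y a y' ≠ ∞ := by
    rw [hNrm]; exact ENNReal.mul_ne_top ENNReal.ofReal_ne_top ENNReal.ofReal_ne_top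
  -- pointwise: (weight of the crux layout on `E`) · N₁N₂ = (tree weight · 𝟙[disjoint]) ∘ swap
  have hpt : ∀ pq : Current.FourCfg (BoxGraph n),
      {pq : Current.FourCfg (BoxGraph n) | ∀ u : ↥(box 3 n),
          ¬ (pq.1 ∈ tracedConn (BoxGraph n) o u ∧ pq.2 ∈ tracedConn (BoxGraph n) a u)}.indicator
        (fun pq => ENNReal.ofReal (pairWeight (BoxGraph n) (criticalBeta 3) ({o} ∆ {y}) ∅ pq.1 /
            (currentSum (BoxGraph n) (criticalBeta 3) ({o} ∆ {y}) *
              currentSum (BoxGraph n) (criticalBeta 3) ∅)) *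
          ENNReal.ofReal (pairWeight (BoxGraph n) (criticalBeta 3) ({a} ∆ {y'}) ∅ pq.2 /
            (currentSum (BoxGraph n) (criticalBeta 3) ({a} ∆ {y'}) *
              currentSum (BoxGraph n) (criticalBeta 3) ∅))) pq * (N₁ * N₂) =
      Current.srcWeight (Kc n) ({o} ∆ {y}) ({a} ∆ {y'}) (swapEquiv n pq) *
        disjInd n o a (swapEquiv n pq) := by
    intro pq
    have hw : ENNReal.ofReal (pairWeight (BoxGraph n) (criticalBeta 3) ({o} ∆ {y}) ∅ pq.1 /
            (currentSum (BoxGraph n) (criticalBeta 3) ({o} ∆ {y}) *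
              currentSum (BoxGraph n) (criticalBeta 3) ∅)) *
          ENNReal.ofReal (pairWeight (BoxGraph n) (criticalBeta 3) ({a} ∆ {y'}) ∅ pq.2 /
            (currentSum (BoxGraph n) (criticalBeta 3) ({a} ∆ {y'}) *
              currentSum (BoxGraph n) (criticalBeta 3) ∅)) * (N₁ * N₂) =
        Current.srcWeight (Kc n) ({o} ∆ {y}) ({a} ∆ {y'}) (swapEquiv n pq) := by
      rw [mul_mul_mul_comm, hN₁, hN₂,
        ← ENNReal.ofReal_mul (div_nonneg (pairWeight_nonneg _ hβ _ _ _) hZ₁pos.le),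
        ← ENNReal.ofReal_mul (div_nonneg (pairWeight_nonneg _ hβ _ _ _) hZ₂pos.le),
        div_mul_cancel₀ _ hZ₁, div_mul_cancel₀ _ hZ₂,
        ofReal_pairWeight_eq_epairWeight_swap _ hβ, ofReal_pairWeight_eq_epairWeight_swap _ hβ]
      rfl
    by_cases hmem : pq ∈ {pq : Current.FourCfg (BoxGraph n) | ∀ u : ↥(box 3 n),
        ¬ (pq.1 ∈ tracedConn (BoxGraph n) o u ∧ pq.2 ∈ tracedConn (BoxGraph n) a u)}
    · rw [Set.indicator_of_mem hmem, hw, disjInd_swap_eq_indicator, Set.indicator_of_mem hmem, mul_one]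
    · rw [Set.indicator_of_notMem hmem, zero_mul, disjInd_swap_eq_indicator,
        Set.indicator_of_notMem hmem, mul_zero]
  -- sum: μ(E) · Nrm = Mass(𝟙[disjoint])
  have hsum : ((doubleCurrentMeasure (BoxGraph n) (criticalBeta 3) ({o} ∆ {y}) ∅).prod
        (doubleCurrentMeasure (BoxGraph n) (criticalBeta 3) ({a} ∆ {y'}) ∅))
      {pq | ∀ u : ↥(box 3 n), ¬ (pq.1 ∈ tracedConn (BoxGraph n) o u ∧
        pq.2 ∈ tracedConn (BoxGraph n) a u)} * Nrm n o y a y' =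
      Mass n o y a y' (disjInd n o a) := by
    rw [prod_doubleCurrentMeasure_apply, hNrm, ← ENNReal.tsum_mul_right]
    simp only [hpt]
    exact (swapEquiv n).tsum_eq fun pq =>
      Current.srcWeight (Kc n) ({o} ∆ {y}) ({a} ∆ {y'}) pq * disjInd n o a pq
  -- conclude
  have hle : ((doubleCurrentMeasure (BoxGraph n) (criticalBeta 3) ({o} ∆ {y}) ∅).prod
        (doubleCurrentMeasure (BoxGraph n) (criticalBeta 3) ({a} ∆ {y'}) ∅))
      {pq | ∀ u : ↥(box 3 n), ¬ (pq.1 ∈ tracedConn (BoxGraph n) o u ∧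
        pq.2 ∈ tracedConn (BoxGraph n) a u)} ≤ ENNReal.ofReal ε := by
    rw [← ENNReal.mul_le_mul_iff_left hNrm0 hNrmT, hsum]
    exact hM
  rw [measureReal_def]
  exact ENNReal.toReal_le_of_le_ofReal hε hle

/-! ### §4. The kernel-checked composition -/

/-- **The line closes the crux BY NAME** from the six registered stubs (FIRST theorem of the file
concluding the route decl, as the by-name skeleton audit requires): `by_cases BranchG` — the dominant
branch is the sibling line (`stub_dominantBranch`), the marginal branch runs
`stub_sloppyLaw → stub_mixing ∧ stub_pzWindows ∧ stub_uniqueCrossings → stub_assembly` — both landing on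
`AvoidanceVanishes`; then the crux's quantifier block is unpacked and the PROVED dictionary
`prod_real_le_of_mass_le` turns the mass bound into the route decl's product-measure bound. -/
theorem RungOneAdjacentMerging_of :
    Summit.CriticalPhenomena.Ising3DConformalLimit.Theses.EnergyNotSigmaSquared.RungOneAdjacentMerging := by
  have hAV : AvoidanceVanishes := by
    by_cases hG : BranchG
    · exact stub_dominantBranch hG
    · exact stub_assembly (stub_mixing (stub_sloppyLaw hG)) (stub_pzWindows (stub_sloppyLaw hG))
        (stub_uniqueCrossings (stub_sloppyLaw hG))
  intro ε hε
  obtain ⟨R, hR⟩ := hAV ε hε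
  refine ⟨R, fun x hx => ?_⟩
  obtain ⟨n₀, hn₀⟩ := hR x hx
  refine ⟨n₀, fun n hn o a y y' ho ha hy hy' => ?_⟩
  exact prod_real_le_of_mass_le o a y y' hε.le (hn₀ n hn o a y y' ho ha hy hy')

/-- The route decl's BODY, verbatim (namespace-shortened): theorems below conclude `CruxBody` rather
than the decl name so that the by-name skeleton audit sees exactly ONE theorem concluding
`RungOneAdjacentMerging` (`RungOneAdjacentMerging_of` above); `cruxBody_iff` is `Iff.rfl`. -/
def CruxBody : Prop :=
  ∀ ε : ℝ, 0 < ε → ∃ R : ℝ, ∀ x : Site 3, R ≤ ‖x‖ → ∃ n₀ : ℕ, ∀ n : ℕ, n₀ ≤ n → ∀ o a y y' : ↥(box 3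
    n), (o : Site 3) = 0 → (a : Site 3) = Pi.single 1 1 → (y : Site 3) = x → (y' : Site 3) = x +
    Pi.single 1 1 → ((doubleCurrentMeasure ((zdGraph 3).comap (Subtype.val : ↥(box 3 n) → Site 3))
    (criticalBeta 3) (symmDiff {o} {y}) ∅).prod (doubleCurrentMeasure ((zdGraph 3).comap
    (Subtype.val : ↥(box 3 n) → Site 3)) (criticalBeta 3) (symmDiff {a} {y'}) ∅)).real {pq | ∀ u :
    ↥(box 3 n), ¬ (pq.1 ∈ tracedConn ((zdGraph 3).comap (Subtype.val : ↥(box 3 n) → Site 3)) o u ∧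
    pq.2 ∈ tracedConn ((zdGraph 3).comap (Subtype.val : ↥(box 3 n) → Site 3)) a u)} ≤ ε

/-- `CruxBody` IS the route decl (definitional unfolding). -/
theorem cruxBody_iff :
    CruxBody ↔
      Summit.CriticalPhenomena.Ising3DConformalLimit.Theses.EnergyNotSigmaSquared.RungOneAdjacentMerging :=
  Iff.rfl

/-- **The dictionary as an implication** (sorry-free, standard axioms): the mass form implies the
route decl's statement. -/
theorem cruxBody_of_avoidanceVanishes (h : AvoidanceVanishes) : CruxBody := by
  intro ε hε
  obtain ⟨R, hR⟩ := h ε hε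
  refine ⟨R, fun x hx => ?_⟩
  obtain ⟨n₀, hn₀⟩ := hR x hx
  refine ⟨n₀, fun n hn o a y y' ho ha hy hy' => ?_⟩
  exact prod_real_le_of_mass_le o a y y' hε.le (hn₀ n hn o a y y' ho ha hy hy')

/-- The composition with the six stub STATEMENTS as hypotheses (`type_of%`), hence closed with
standard axioms only: exactly these six statements imply the crux's statement (the by-name version
is `RungOneAdjacentMerging_of`). -/
theorem cruxBody_of_parts
    (hDom : type_of% stub_dominantBranch) (hLaw : type_of% stub_sloppyLaw)
    (hMix : type_of% stub_mixing) (hPZ : type_of% stub_pzWindows)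
    (hUni : type_of% stub_uniqueCrossings) (hAsm : type_of% stub_assembly) : CruxBody := by
  refine cruxBody_of_avoidanceVanishes ?_
  by_cases hG : BranchG
  · exact hDom hG
  · exact hAsm (hMix (hLaw hG)) (hPZ (hLaw hG)) (hUni (hLaw hG))

end Summit.CriticalPhenomena.Ising3DConformalLimit.Cruxes.RungOneAdjacentMerging.MarginalBranchPowerLawMachine

end
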